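import Summits.AtomisticToContinuum.BoseEinsteinCondensation.Theorems.BECGroundStateSOSPeriodicIRBoundTwoSectorDefs
import Summits.AtomisticToContinuum.BoseEinsteinCondensation.Theorems.BECGroundStateSOSPeriodicIRBoundWFKinematics
import Summits.AtomisticToContinuum.BoseEinsteinCondensation.Theorems.BECGroundStateSOSPeriodicIRBoundWFRegularity
import Mathlib.MeasureTheory.Integral.MeanInequalities
import HarnessLib

/-!
# Route `BECGroundStateSOS`, crux `PeriodicIRBound` (stmt-AtomisticToContinuum-3972), line `two-sector-gd-transfer` —
# stub S3 `stub_katoSusceptibility : KatoSusceptibility` (the Kato / discriminant step on near-minimisers)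

For an integrable admissible pair potential `v` and data `(K, ρ₀, C)`, two-sector Gaussian domination
`GDFor v K ρ₀ C` (the body of stmt-AtomisticToContinuum-12620, per potential) implies the two-channel susceptibility
bound `TwoChannelSusceptibility v K ρ₀ C` with the same data: eventually in `N`, on every torus with
`(N+1) ≤ ρ₀L³` and finite `E₀(N), E₀(N+1)`, for every mode `n ≠ 0` with `2π‖n‖_∞/L ≤ K`, both regularised channel
susceptibilities `SuscPlus v N L n b`, `SuscMinus v N L n b` hold with `b = CL²/‖n‖²_∞`.

Proof (channel `+`; channel `−` is the mirror image `p ↔ 1 − p`). Write `M = √(N+1)·I(Ψ,Φ) = Re⟨Ψ, a(φ_n)Φ⟩`,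
`Y = E(Ψ) − E₀(N)`, `X = E(Φ) − E₀(N+1) ≥ 0`. Given `η > 0` and the GD threshold `t₀ > 0` choose
`q = min(η/(1+η), t₀²b²/(N+1), 1/2)` and the slack `δ = ηq`; for a `δ`-near-minimiser `Ψ` (`Y ≤ ηq`) test GD at
`p = 1 − q`, `t = −√(q(1−q))·M/b` (admissible, `|t| ≤ t₀`, by the a priori bound `M² ≤ N+1`, which is Cauchy–Schwarz on
the cell together with `‖a(φ_n)Φ‖² = n_φ(Φ) ≤ (N+1)‖Φ‖²`): `q(1−q)M²/b ≤ (1−q)Y + qX`, whence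
`(1−q)M² ≤ b((1−q)η + X)` and `M² ≤ b((1+η)X + η)` because `1/(1−q) ≤ 1+η`.

* §1 `Kato.core` — the real-arithmetic core (inputs: `b, η, t₀ > 0`, the slack `q`, `M² ≤ A`, `Y ≤ ηq`, `0 ≤ X` and
  the GD inequality for all `|t| ≤ t₀`, `p ∈ [0,1]`), and its mirror `Kato.core'` (near side weighted by `1 − p`).
* §2 `Kato.norm_integral_conj_mul_le` (Cauchy–Schwarz on the cell, adapted from
  `TraceCauchy.norm_integral_conj_mul_le`), `Kato.transfer_sq_le` (`M² ≤ N+1`).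
* §3 `Kato.suscPlus_of_gd`, `Kato.suscMinus_of_gd` (the `ℝ≥0∞ → ℝ` bookkeeping at fixed `(N, L, n)`),
  `Kato.twoChannel_of_gd`, and the registered one-liner `stub_katoSusceptibility`.

References: T. Kennedy, E. H. Lieb, B. S. Shastry, J. Stat. Phys. 53 (1988) 1019, (12)–(14); T. Kato,
*Perturbation Theory for Linear Operators* (1966), II §2 (the second-order/discriminant step); F. J. Dyson,
E. H. Lieb, B. Simon, J. Stat. Phys. 18 (1978) 335, §1.
-/

noncomputable section

open scoped BigOperators ENNReal ComplexConjugate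
open Filter MeasureTheory

namespace Summit.AtomisticToContinuum.BoseEinsteinCondensation.Cruxes.PeriodicIRBound.TwoSectorGdTransfer

open Literature.MathematicalPhysics.QuantumManyBody.BoseGas
open Summit.AtomisticToContinuum.BoseEinsteinCondensation.Cruxes.PeriodicIRBound.LinearPhFloorWagner

namespace Kato

/-! ## §1 The real-arithmetic core of the Kato / discriminant step -/

/-- **The Kato / discriminant step over `ℝ`** (near side weighted by `p`). Let `b, η, t₀ > 0`, let the slack `q` satisfy
`0 < q ≤ 1/2`, `q ≤ η/(1+η)`, `qA ≤ t₀²b²`, and suppose `M² ≤ A`, `Ea − Fa ≤ ηq` (the near-minimiser side),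
`0 ≤ Eb − Fb` (the free side) and the two-sector Gaussian-domination inequality
`p·Fa + (1−p)·Fb − b t² ≤ p·Ea + (1−p)·Eb + 2t√(p(1−p))·M` for all `|t| ≤ t₀`, `p ∈ [0,1]`. Then
`M² ≤ b((1+η)(Eb − Fb) + η)`: test at `p = 1 − q`, `t = −√(q(1−q))M/b`. [cite: KLS1988JSP, (12)–(14)] -/
theorem core {b t₀ η A q M Ea Fa Eb Fb : ℝ} (hb : 0 < b) (ht₀ : 0 < t₀) (hη : 0 < η)
    (hq : 0 < q) (hq2 : q ≤ 1 / 2) (hqη : q ≤ η / (1 + η)) (hqt : q * A ≤ t₀ ^ 2 * b ^ 2)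
    (hM : M ^ 2 ≤ A) (hYa : Ea - Fa ≤ η * q) (hXb : 0 ≤ Eb - Fb)
    (hGD : ∀ t : ℝ, |t| ≤ t₀ → ∀ p : ℝ, 0 ≤ p → p ≤ 1 →
      p * Fa + (1 - p) * Fb - b * t ^ 2 ≤ p * Ea + (1 - p) * Eb + 2 * t * Real.sqrt (p * (1 - p)) * M) :
    M ^ 2 ≤ b * ((1 + η) * (Eb - Fb) + η) := by
  have hq1 : 0 < 1 - q := by linarith
  have hqq : 0 ≤ q * (1 - q) := mul_nonneg hq.le hq1.le
  set r := Real.sqrt (q * (1 - q)) with hr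
  have hr2 : r ^ 2 = q * (1 - q) := Real.sq_sqrt hqq
  -- the test parameter `t = -r M / b`
  set t := -(r * M / b) with ht
  have ht2 : t ^ 2 = q * (1 - q) * M ^ 2 / b ^ 2 := by
    rw [ht, neg_sq, div_pow, mul_pow, hr2]
  have htt : |t| ≤ t₀ := by
    refine abs_le_of_sq_le_sq ?_ ht₀.le
    rw [ht2, div_le_iff₀ (by positivity)]
    have hM0 : 0 ≤ M ^ 2 := sq_nonneg M
    nlinarith [mul_le_mul_of_nonneg_left hM hq.le, mul_nonneg hq.le hM0]
  have hGD' := hGD t htt (1 - q) hq1.le (by linarith)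
  have hsq : Real.sqrt ((1 - q) * (1 - (1 - q))) = r := by
    rw [hr, sub_sub_cancel, mul_comm]
  rw [hsq, sub_sub_cancel] at hGD'
  -- `2 t r M = -2 q(1-q) M²/b` and `b t² = q(1-q) M²/b`
  have h2t : 2 * t * r * M = -(2 * (q * (1 - q) * M ^ 2 / b)) := by
    rw [ht, ← hr2]
    ring
  have htb : b * t ^ 2 = q * (1 - q) * M ^ 2 / b := by
    rw [ht2]
    field_simp
  -- the key inequality `q(1-q)M²/b ≤ (1-q)Y + qX`
  have hkey : q * (1 - q) * M ^ 2 / b ≤ (1 - q) * (Ea - Fa) + q * (Eb - Fb) := by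
    linarith [hGD', htb, h2t]
  rw [div_le_iff₀ hb] at hkey
  have hY' : (1 - q) * (Ea - Fa) ≤ (1 - q) * (η * q) := mul_le_mul_of_nonneg_left hYa hq1.le
  -- cancel `q > 0`: `(1-q) M² ≤ b((1-q)η + X)`
  have h3 : q * ((1 - q) * M ^ 2) ≤ q * (b * ((1 - q) * η + (Eb - Fb))) := by nlinarith
  have hkey' : (1 - q) * M ^ 2 ≤ b * ((1 - q) * η + (Eb - Fb)) := le_of_mul_le_mul_left h3 hq
  -- `1 ≤ (1-q)(1+η)` from `q ≤ η/(1+η)`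
  have h4 : 1 ≤ (1 - q) * (1 + η) := by
    rw [le_div_iff₀ (by linarith)] at hqη
    nlinarith
  have hbX : 0 ≤ b * (Eb - Fb) := mul_nonneg hb.le hXb
  have h5 : (1 - q) * M ^ 2 ≤ (1 - q) * (b * ((1 + η) * (Eb - Fb) + η)) := by
    nlinarith [mul_le_mul_of_nonneg_left h4 hbX]
  exact le_of_mul_le_mul_left h5 hq1

/-- **The Kato / discriminant step over `ℝ`, mirror form** (near side weighted by `1 − p`): the same conclusion when the
near-minimiser side `(Ea, Fa)` carries the weight `1 − p` and the free side `(Eb, Fb)` the weight `p` in the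
Gaussian-domination inequality — substitute `p ↦ 1 − p` in `core`. [cite: KLS1988JSP, (12)–(14)] -/
theorem core' {b t₀ η A q M Ea Fa Eb Fb : ℝ} (hb : 0 < b) (ht₀ : 0 < t₀) (hη : 0 < η)
    (hq : 0 < q) (hq2 : q ≤ 1 / 2) (hqη : q ≤ η / (1 + η)) (hqt : q * A ≤ t₀ ^ 2 * b ^ 2)
    (hM : M ^ 2 ≤ A) (hYa : Ea - Fa ≤ η * q) (hXb : 0 ≤ Eb - Fb)
    (hGD : ∀ t : ℝ, |t| ≤ t₀ → ∀ p : ℝ, 0 ≤ p → p ≤ 1 →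
      p * Fb + (1 - p) * Fa - b * t ^ 2 ≤ p * Eb + (1 - p) * Ea + 2 * t * Real.sqrt (p * (1 - p)) * M) :
    M ^ 2 ≤ b * ((1 + η) * (Eb - Fb) + η) := by
  refine core hb ht₀ hη hq hq2 hqη hqt hM hYa hXb fun t ht p hp0 hp1 => ?_
  have h := hGD t ht (1 - p) (by linarith) (by linarith)
  rw [sub_sub_cancel, mul_comm (1 - p) p] at h
  linarith

/-! ## §2 The a priori bound `M² ≤ N + 1` (Cauchy–Schwarz on the cell) -/

/-- **Cauchy–Schwarz on the cell**: `‖∫_cell conj(f) g‖ ≤ √(∫_cell |f|²) √(∫_cell |g|²)` for continuous `f, g` of finite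
cell mass (Hölder with `p = q = 2` for the lower Lebesgue integral). [folklore] -/
theorem norm_integral_conj_mul_le (L : ℝ) {N : ℕ} {f g : Config N → ℂ} (hf : Continuous f)
    (hg : Continuous g) (hf2 : ∫⁻ X in cellN N L, ((‖f X‖₊ : ℝ≥0∞)) ^ 2 ≠ ⊤)
    (hg2 : ∫⁻ X in cellN N L, ((‖g X‖₊ : ℝ≥0∞)) ^ 2 ≠ ⊤) :
    ‖∫ X in cellN N L, conj (f X) * g X‖ ≤
      Real.sqrt ((∫⁻ X in cellN N L, ((‖f X‖₊ : ℝ≥0∞)) ^ 2).toReal) *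
        Real.sqrt ((∫⁻ X in cellN N L, ((‖g X‖₊ : ℝ≥0∞)) ^ 2).toReal) := by
  -- adapted from `TraceCauchy.norm_integral_conj_mul_le` (Theorems/BECConjugateDominationHardCoreExtensionTraceCauchy.lean)
  have hH := ENNReal.lintegral_mul_le_Lp_mul_Lq (volume.restrict (cellN N L))
    Real.HolderConjugate.two_two hf.measurable.enorm.aemeasurable hg.measurable.enorm.aemeasurable
  have h1 : ‖∫ X in cellN N L, conj (f X) * g X‖ₑ ≤
      (∫⁻ X in cellN N L, ((‖f X‖₊ : ℝ≥0∞)) ^ 2) ^ (1 / 2 : ℝ) *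
        (∫⁻ X in cellN N L, ((‖g X‖₊ : ℝ≥0∞)) ^ 2) ^ (1 / 2 : ℝ) :=
    calc ‖∫ X in cellN N L, conj (f X) * g X‖ₑ ≤ ∫⁻ X in cellN N L, ‖conj (f X) * g X‖ₑ :=
        enorm_integral_le_lintegral_enorm _
      _ = ∫⁻ X in cellN N L, ‖f X‖ₑ * ‖g X‖ₑ := by simp_rw [enorm_mul, RCLike.enorm_conj]
      _ ≤ _ := by simpa only [Pi.mul_apply, ENNReal.rpow_two, enorm_eq_nnnorm] using hH
  have hR : (∫⁻ X in cellN N L, ((‖f X‖₊ : ℝ≥0∞)) ^ 2) ^ (1 / 2 : ℝ) *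
      (∫⁻ X in cellN N L, ((‖g X‖₊ : ℝ≥0∞)) ^ 2) ^ (1 / 2 : ℝ) ≠ ⊤ :=
    ENNReal.mul_ne_top (ENNReal.rpow_ne_top_of_nonneg (by norm_num) hf2)
      (ENNReal.rpow_ne_top_of_nonneg (by norm_num) hg2)
  have h2 := ENNReal.toReal_mono hR h1
  rw [toReal_enorm, ENNReal.toReal_mul, ← ENNReal.toReal_rpow, ← ENNReal.toReal_rpow] at h2
  rwa [Real.sqrt_eq_rpow, Real.sqrt_eq_rpow]

/-- **A priori bound on the transfer matrix element**: `M² = (Re⟨Ψ, a(φ_n)Φ⟩)² ≤ N + 1` for normalised `Ψ` (`N` bodies)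
and `Φ` (`N+1` bodies) — Cauchy–Schwarz on the cell, `‖a(φ_n)Φ‖² = n_φ(Φ) ≤ (N+1)‖Φ‖² = N+1` (`WF.normSq_modeAn`,
`WF.cellOccupation_le_mul_normSq`). [folklore] -/
theorem transfer_sq_le {N : ℕ} {L : ℝ} (hL : 0 < L) (n : Fin 3 → ℤ) (Ψ : PeriodicTrialState N L)
    (Φ : PeriodicTrialState (N + 1) L) :
    (Real.sqrt ((N : ℝ) + 1) * transferIntegralRe L n Ψ.ψ Φ.ψ) ^ 2 ≤ (N : ℝ) + 1 := by
  rw [sqrt_mul_transferIntegralRe]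
  set g := modeAn L (planeWaveMode L n) Φ.ψ with hg
  have hΨc : Continuous Ψ.ψ := Ψ.contDiff.continuous
  have hΦc : Continuous Φ.ψ := Φ.contDiff.continuous
  have hgc : Continuous g := WF.continuous_modeAn L (continuous_planeWaveMode L n) hΦc
  have hΨ1 : (∫⁻ X in cellN N L, ((‖Ψ.ψ X‖₊ : ℝ≥0∞)) ^ 2) = 1 := Ψ.norm_eq
  have hg2 : (∫⁻ X in cellN N L, ((‖g X‖₊ : ℝ≥0∞)) ^ 2) ≤ ((N + 1 : ℕ) : ℝ≥0∞) := by
    have h1 : WF.normSq L g ≤ ((N + 1 : ℕ) : ℝ≥0∞) * WF.normSq L Φ.ψ := by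
      rw [hg, WF.normSq_modeAn hL n Φ.ψ]
      exact WF.cellOccupation_le_mul_normSq hL n hΦc
    have h2 : WF.normSq L Φ.ψ = 1 := Φ.norm_eq
    rw [h2, mul_one] at h1
    exact h1
  have hg2' : (∫⁻ X in cellN N L, ((‖g X‖₊ : ℝ≥0∞)) ^ 2) ≠ ⊤ :=
    ne_top_of_le_ne_top (ENNReal.natCast_ne_top _) hg2
  have hCS := norm_integral_conj_mul_le L hΨc hgc (by rw [hΨ1]; exact ENNReal.one_ne_top) hg2'
  rw [hΨ1, ENNReal.toReal_one, Real.sqrt_one, one_mul] at hCS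
  have hm : (∫⁻ X in cellN N L, ((‖g X‖₊ : ℝ≥0∞)) ^ 2).toReal ≤ (N : ℝ) + 1 := by
    have := ENNReal.toReal_mono (ENNReal.natCast_ne_top (N + 1)) hg2
    rw [ENNReal.toReal_natCast] at this
    push_cast at this
    exact this
  set I := ∫ X in cellN N L, conj (Ψ.ψ X) * g X with hI
  have hre : |I.re| ≤ ‖I‖ := Complex.abs_re_le_norm I
  calc I.re ^ 2 ≤ ‖I‖ ^ 2 := sq_le_sq' (abs_le.1 hre).1 (abs_le.1 hre).2
    _ ≤ Real.sqrt ((∫⁻ X in cellN N L, ((‖g X‖₊ : ℝ≥0∞)) ^ 2).toReal) ^ 2 :=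
        pow_le_pow_left₀ (norm_nonneg _) hCS 2
    _ = (∫⁻ X in cellN N L, ((‖g X‖₊ : ℝ≥0∞)) ^ 2).toReal := Real.sq_sqrt ENNReal.toReal_nonneg
    _ ≤ (N : ℝ) + 1 := hm

/-! ## §3 The channels at fixed `(N, L, n)` and the assembly -/

/-- The slack exponent of the Kato step: for `η, t₀, b, A > 0` there is `q` with `0 < q ≤ 1/2`, `q ≤ η/(1+η)`,
`qA ≤ t₀²b²` (namely `q = min(η/(1+η), t₀²b²/A, 1/2)`). [folklore] -/
theorem exists_slack {η t₀ b A : ℝ} (hη : 0 < η) (ht₀ : 0 < t₀) (hb : 0 < b) (hA : 0 < A) :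
    ∃ q : ℝ, 0 < q ∧ q ≤ 1 / 2 ∧ q ≤ η / (1 + η) ∧ q * A ≤ t₀ ^ 2 * b ^ 2 :=
  ⟨min (η / (1 + η)) (min (t₀ ^ 2 * b ^ 2 / A) (1 / 2)),
    lt_min (div_pos hη (by linarith)) (lt_min (by positivity) (by norm_num)),
    (min_le_right _ _).trans (min_le_right _ _), min_le_left _ _,
    (le_div_iff₀ hA).1 ((min_le_right _ _).trans (min_le_left _ _))⟩

/-- **Channel `+` at fixed `(N, L, n)`**: the Gaussian-domination inequality with threshold `t₀ > 0` and coefficient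
`b > 0` (for all finite-energy `Ψ`, `Φ`) together with `E₀(N) ≠ ⊤` gives `SuscPlus v N L n b` — slack `δ = ηq`,
`Kato.core` on the `δ`-near-minimiser `Ψ` of `H_N` and the free `(N+1)`-body `Φ`. [cite: KLS1988JSP, (12)–(14)] -/
theorem suscPlus_of_gd {v : ℝ → ℝ≥0∞} {N : ℕ} {L : ℝ} (hL : 0 < L) {n : Fin 3 → ℤ} {b t₀ : ℝ}
    (hb : 0 < b) (ht₀ : 0 < t₀) (hEN : periodicGroundStateEnergy v N L ≠ ⊤)
    (hGD : ∀ t : ℝ, |t| ≤ t₀ → ∀ p : ℝ, 0 ≤ p → p ≤ 1 →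
      ∀ Ψ : PeriodicTrialState N L, ∀ Φ : PeriodicTrialState (N + 1) L,
        periodicEnergy v Ψ ≠ ⊤ → periodicEnergy v Φ ≠ ⊤ →
          p * (periodicGroundStateEnergy v N L).toReal +
                (1 - p) * (periodicGroundStateEnergy v (N + 1) L).toReal - b * t ^ 2 ≤
            p * (periodicEnergy v Ψ).toReal + (1 - p) * (periodicEnergy v Φ).toReal +
              2 * t * Real.sqrt (p * (1 - p)) * Real.sqrt ((N : ℝ) + 1) * transferIntegralRe L n Ψ.ψ Φ.ψ) :
    SuscPlus v N L n b := by
  intro η hη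
  have hA : (0 : ℝ) < (N : ℝ) + 1 := by positivity
  obtain ⟨q, hq, hq2, hqη, hqt⟩ := exists_slack hη ht₀ hb hA
  have hδ : ENNReal.ofReal (η * q) ≠ ⊤ := ENNReal.ofReal_ne_top
  refine ⟨ENNReal.ofReal (η * q), ENNReal.ofReal_pos.2 (mul_pos hη hq), fun Ψ hΨ Φ hΦ => ?_⟩
  have hΨ' : periodicEnergy v Ψ ≤ periodicGroundStateEnergy v N L + ENNReal.ofReal (η * q) := hΨ
  have htop : periodicGroundStateEnergy v N L + ENNReal.ofReal (η * q) ≠ ⊤ := ENNReal.add_ne_top.2 ⟨hEN, hδ⟩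
  have hΨtop : periodicEnergy v Ψ ≠ ⊤ := ne_top_of_le_ne_top htop hΨ'
  have hYa : (periodicEnergy v Ψ).toReal - (periodicGroundStateEnergy v N L).toReal ≤ η * q := by
    have h1 := ENNReal.toReal_mono htop hΨ'
    rw [ENNReal.toReal_add hEN hδ, ENNReal.toReal_ofReal (mul_pos hη hq).le] at h1
    linarith
  have hXb : 0 ≤ (periodicEnergy v Φ).toReal - (periodicGroundStateEnergy v (N + 1) L).toReal :=
    sub_nonneg.2 (ENNReal.toReal_mono hΦ (periodicGroundStateEnergy_le v Φ))
  exact core hb ht₀ hη hq hq2 hqη hqt (transfer_sq_le hL n Ψ Φ) hYa hXb fun t ht p hp0 hp1 => by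
    simpa only [mul_assoc] using hGD t ht p hp0 hp1 Ψ Φ hΨtop hΦ

/-- **Channel `−` at fixed `(N, L, n)`**: the same Gaussian-domination inequality together with `E₀(N+1) ≠ ⊤` gives
`SuscMinus v N L n b` — `Kato.core'` on the `δ`-near-minimiser `Φ` of `H_{N+1}` and the free `N`-body `Ψ`.
[cite: KLS1988JSP, (12)–(14)] -/
theorem suscMinus_of_gd {v : ℝ → ℝ≥0∞} {N : ℕ} {L : ℝ} (hL : 0 < L) {n : Fin 3 → ℤ} {b t₀ : ℝ}
    (hb : 0 < b) (ht₀ : 0 < t₀) (hEN1 : periodicGroundStateEnergy v (N + 1) L ≠ ⊤)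
    (hGD : ∀ t : ℝ, |t| ≤ t₀ → ∀ p : ℝ, 0 ≤ p → p ≤ 1 →
      ∀ Ψ : PeriodicTrialState N L, ∀ Φ : PeriodicTrialState (N + 1) L,
        periodicEnergy v Ψ ≠ ⊤ → periodicEnergy v Φ ≠ ⊤ →
          p * (periodicGroundStateEnergy v N L).toReal +
                (1 - p) * (periodicGroundStateEnergy v (N + 1) L).toReal - b * t ^ 2 ≤
            p * (periodicEnergy v Ψ).toReal + (1 - p) * (periodicEnergy v Φ).toReal +
              2 * t * Real.sqrt (p * (1 - p)) * Real.sqrt ((N : ℝ) + 1) * transferIntegralRe L n Ψ.ψ Φ.ψ) :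
    SuscMinus v N L n b := by
  intro η hη
  have hA : (0 : ℝ) < (N : ℝ) + 1 := by positivity
  obtain ⟨q, hq, hq2, hqη, hqt⟩ := exists_slack hη ht₀ hb hA
  have hδ : ENNReal.ofReal (η * q) ≠ ⊤ := ENNReal.ofReal_ne_top
  refine ⟨ENNReal.ofReal (η * q), ENNReal.ofReal_pos.2 (mul_pos hη hq), fun Φ hΦ Ψ hΨ => ?_⟩
  have hΦ' : periodicEnergy v Φ ≤ periodicGroundStateEnergy v (N + 1) L + ENNReal.ofReal (η * q) := hΦ
  have htop : periodicGroundStateEnergy v (N + 1) L + ENNReal.ofReal (η * q) ≠ ⊤ :=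
    ENNReal.add_ne_top.2 ⟨hEN1, hδ⟩
  have hΦtop : periodicEnergy v Φ ≠ ⊤ := ne_top_of_le_ne_top htop hΦ'
  have hYa : (periodicEnergy v Φ).toReal - (periodicGroundStateEnergy v (N + 1) L).toReal ≤ η * q := by
    have h1 := ENNReal.toReal_mono htop hΦ'
    rw [ENNReal.toReal_add hEN1 hδ, ENNReal.toReal_ofReal (mul_pos hη hq).le] at h1
    linarith
  have hXb : 0 ≤ (periodicEnergy v Ψ).toReal - (periodicGroundStateEnergy v N L).toReal :=
    sub_nonneg.2 (ENNReal.toReal_mono hΨ (periodicGroundStateEnergy_le v Ψ))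
  exact core' hb ht₀ hη hq hq2 hqη hqt (transfer_sq_le hL n Ψ Φ) hYa hXb fun t ht p hp0 hp1 => by
    simpa only [mul_assoc] using hGD t ht p hp0 hp1 Ψ Φ hΨ hΦtop

/-- **The Kato step with data `(K, ρ₀, C)`**: `GDFor v K ρ₀ C` and `C > 0` give `TwoChannelSusceptibility v K ρ₀ C`
(`b = CL²/‖n‖²_∞ > 0` since `n ≠ 0`; `C t² L²/‖n‖² = b t²`). [cite: KLS1988JSP, (12)–(14)] -/
theorem twoChannel_of_gd {v : ℝ → ℝ≥0∞} {K ρ₀ C : ℝ} (hC : 0 < C) (hGD : GDFor v K ρ₀ C) :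
    TwoChannelSusceptibility v K ρ₀ C := by
  unfold TwoChannelSusceptibility
  unfold GDFor at hGD
  filter_upwards [hGD] with N hN
  intro L hL hρ hEN hEN1 n hn hnK
  obtain ⟨t₀, ht₀, h⟩ := hN L hL hρ n hn hnK
  have hnorm : 0 < ‖(fun j => (n j : ℝ))‖ := by
    obtain ⟨j, hj⟩ := Function.ne_iff.1 hn
    refine norm_pos_iff.2 fun h0 => hj ?_
    have := congr_fun h0 j
    simp only [Pi.zero_apply, Int.cast_eq_zero] at this
    exact this
  have hb : 0 < C * L ^ 2 / ‖(fun j => (n j : ℝ))‖ ^ 2 := div_pos (mul_pos hC (pow_pos hL 2)) (pow_pos hnorm 2)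
  have h' : ∀ t : ℝ, |t| ≤ t₀ → ∀ p : ℝ, 0 ≤ p → p ≤ 1 →
      ∀ Ψ : PeriodicTrialState N L, ∀ Φ : PeriodicTrialState (N + 1) L,
        periodicEnergy v Ψ ≠ ⊤ → periodicEnergy v Φ ≠ ⊤ →
          p * (periodicGroundStateEnergy v N L).toReal +
                (1 - p) * (periodicGroundStateEnergy v (N + 1) L).toReal -
              C * L ^ 2 / ‖(fun j => (n j : ℝ))‖ ^ 2 * t ^ 2 ≤
            p * (periodicEnergy v Ψ).toReal + (1 - p) * (periodicEnergy v Φ).toReal +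
              2 * t * Real.sqrt (p * (1 - p)) * Real.sqrt ((N : ℝ) + 1) * transferIntegralRe L n Ψ.ψ Φ.ψ := by
    intro t ht p hp0 hp1 Ψ Φ hΨ hΦ
    have h1 := h t ht p hp0 hp1 Ψ Φ hΨ hΦ
    have h2 : C * t ^ 2 * L ^ 2 / ‖(fun j => (n j : ℝ))‖ ^ 2 = C * L ^ 2 / ‖(fun j => (n j : ℝ))‖ ^ 2 * t ^ 2 := by
      ring
    linarith
  exact ⟨suscPlus_of_gd hL hb ht₀ hEN h', suscMinus_of_gd hL hb ht₀ hEN1 h'⟩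

end Kato

/-- **Registered stub S3 `stub_katoSusceptibility` of line `two-sector-gd-transfer`** (crux `PeriodicIRBound`,
stmt-AtomisticToContinuum-3972): the Kato / discriminant step on near-minimisers — for every integrable admissible `v` and
data `(K, ρ₀, C)` with `C > 0`, `GDFor v K ρ₀ C → TwoChannelSusceptibility v K ρ₀ C` (`Kato.twoChannel_of_gd`; the
admissibility and integrability hypotheses are not used). [cite: KLS1988JSP, (12)–(14)] -/
theorem stub_katoSusceptibility : KatoSusceptibility :=
  fun _v _hv _hint _K _ρ₀ _C hC hGD => Kato.twoChannel_of_gd hC hGD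

end Summit.AtomisticToContinuum.BoseEinsteinCondensation.Cruxes.PeriodicIRBound.TwoSectorGdTransfer

end
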